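import Mathlib
import Summits.Ventures.PercRepro2.TypedPendant

/-!
# Typed-base reductions IV: series edges (blind cell PercRepro2, night-3 g2, 2026-08-24;
rule (a) of `proofs/LEAD-TYPED-REDUCTION.md` §1, kernel-checked)

* **`typedCount_series`** (rule (a)): two typed edges `e = {u, w}`, `f = {w, v}` of mixed types in
  series at an UNMARKED vertex `w` all of whose other edges are pinned closed (in particular `w`
  of degree two: `typedCount_series_deg2`) merge into the single typed edge `e` with `f` pinned
  open (so `e` joins `u` to `v` through `w`), with the nonnegative integer multiplicities `muAnd`
  (`#{(X, Y) ⊆ {1,2,3} : |X| = τ e, |Y| = τ f, X ∩ Y = Z}`):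
  `N_τ = Σ_{j ≤ 3} muAnd (τ e) (τ f) j · N_{τ[e := j]}(f open)`;
* the graph lemma behind it, `conn_series`: the connections among vertices other than `w` in
  `x[e ↦ p][f ↦ a]` are those of `x[f ↦ open][e ↦ p ∧ a]` — from the CONFIGURATION-LEVEL leaf
  lemma `conn_update_closed_at_iff` (if every other edge at `w` is closed in `ω`, the state of
  `e = {w, u}` does not affect the connections off `w`) and `st_series` for the states;
* `typedCount_congr_K_on` (kernels agreeing on the support have equal counts) and
  `typedCount_repin_false` (a pinned edge may be pinned closed instead, the copies being re-opened
  by the kernel — the tool that moves the pinned value of `f` between the two sides of the rule).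
-/

namespace Summit.Ventures.PercRepro2

namespace CovForm

namespace TypedRed

open OneTyped

/-! ## Support congruence -/

section Support

variable {E : Type*} [Fintype E] [DecidableEq E] {R : Type*} [CommRing R]

/-- Kernels that agree on the support of the typed count (the triples agreeing with `z` off `F`
and typed on `F`) have equal typed counts. -/
lemma typedCount_congr_K_on (F : Finset E) (z : Config E) (τ : E → ℕ)
    {K K' : Config E → Config E → Config E → R}
    (h : ∀ x y w, (∀ e, e ∉ F → x e = z e ∧ y e = z e ∧ w e = z e) →
      (∀ e ∈ F, openCount x y w e = τ e) → K x y w = K' x y w) :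
    typedCount F z τ K = typedCount F z τ K' := by
  unfold typedCount
  refine Finset.sum_congr rfl fun x _ => Finset.sum_congr rfl fun y _ =>
    Finset.sum_congr rfl fun w _ => ?_
  split_ifs with hc
  · exact h x y w hc.1 hc.2
  · rfl

end Support

/-! ## Re-pinning a pinned edge -/

section Repin

variable {E : Type*} [Fintype E] [DecidableEq E] {R : Type*} [CommRing R]

/-- A pinned edge `f ∉ F` may be pinned closed instead, the copies being re-opened by the kernel. -/
lemma typedCount_repin_false (F : Finset E) (f : E) (hf : f ∉ F) (z : Config E) (τ : E → ℕ)
    (K : Config E → Config E → Config E → R) :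
    typedCount F z τ K =
      typedCount F (Function.update z f false) τ
        (fun x y w => K (Function.update x f (z f)) (Function.update y f (z f))
          (Function.update w f (z f))) := by
  have h := typedCount_insert_pinned F f hf z τ K
  have hF : (insert f F).erase f = F := Finset.erase_insert hf
  cases hz : z f
  · have h0 : (if false = true then 3 else 0) = 0 := rfl
    rw [hz, h0] at h
    rw [← h, typedCount_split_zero (insert f F) f (Finset.mem_insert_self f F), hF]
  · have h3 : (if true = true then 3 else 0) = 3 := rfl
    rw [hz, h3] at h
    rw [← h, typedCount_split_three (insert f F) f (Finset.mem_insert_self f F), hF]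

end Repin

/-! ## The configuration-level leaf lemma -/

section ConfigLeaf

variable {V : Type*} {E : Type*} [DecidableEq E]

/-- If every edge at `w` other than `e = {w, u}` is closed in `ω`, then `w` is isolated once `e` is
closed. -/
lemma conn_closed_at_eq {ends : E → Sym2 V} {ω : Config E} {w u : V} {e : E}
    (he : ends e = s(w, u)) (hcl : ∀ e', e' ≠ e → w ∈ ends e' → ω e' = false) (hωe : ω e = false)
    {v : V} (h : Conn ends ω w v) : v = w := by
  have hS : ∀ x ∈ ({w} : Set V), ∀ y, (openGraph ends ω).Adj x y → y ∈ ({w} : Set V) := by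
    intro x hx y hxy
    rw [Set.mem_singleton_iff] at hx
    subst hx
    obtain ⟨_, g, hg, hends⟩ := openGraph_adj.1 hxy
    by_cases hge : g = e
    · subst hge; rw [hωe] at hg; exact absurd hg Bool.false_ne_true
    · have := hcl g hge (by rw [hends]; exact Sym2.mem_mk_left x y)
      rw [this] at hg; exact absurd hg Bool.false_ne_true
  exact (mem_of_conn_of_closed hS (Set.mem_singleton w) h)

/-- **Configuration-level leaf lemma**: if every edge at `w` other than `e = {w, u}` is closed in
`ω`, the state of `e` does not affect the connections among vertices other than `w`. -/
lemma conn_update_closed_at_iff {ends : E → Sym2 V} {ω : Config E} {w u : V} {e : E}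
    (he : ends e = s(w, u)) (hwu : w ≠ u) (hcl : ∀ e', e' ≠ e → w ∈ ends e' → ω e' = false)
    (c : Bool) {x v : V} (hx : x ≠ w) (hv : v ≠ w) :
    Conn ends (Function.update ω e c) x v ↔ Conn ends (Function.update ω e false) x v := by
  set ω₀ := Function.update ω e false with hω₀
  have hcl₀ : ∀ e', e' ≠ e → w ∈ ends e' → ω₀ e' = false := fun e' he' hw => by
    rw [hω₀, Function.update_of_ne he']; exact hcl e' he' hw
  have hω₀e : ω₀ e = false := Function.update_self e false ω
  have hle : ω₀ ≤ Function.update ω e c := by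
    intro e'
    by_cases he' : e' = e
    · subst he'; rw [hω₀, Function.update_self, Function.update_self]; exact Bool.false_le _
    · rw [hω₀, Function.update_of_ne he', Function.update_of_ne he']
  constructor
  · intro h
    let S : Set V := {y | Conn ends ω₀ x y ∨ (y = w ∧ Conn ends ω₀ x u)}
    have hS : ∀ y ∈ S, ∀ z, (openGraph ends (Function.update ω e c)).Adj y z → z ∈ S := by
      intro y hy z hyz
      obtain ⟨hne, g, hg, hends⟩ := openGraph_adj.1 hyz
      by_cases hge : g = e
      · subst hge
        rw [he, Sym2.eq_iff] at hends
        rcases hends with ⟨rfl, rfl⟩ | ⟨rfl, rfl⟩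
        · -- `y = w`, `z = u`
          rcases hy with hy | ⟨_, hu⟩
          · exact absurd (conn_closed_at_eq he hcl₀ hω₀e (conn_symm hy)) hx
          · exact Or.inl hu
        · -- `y = u`, `z = w`
          rcases hy with hy | ⟨hyw, _⟩
          · exact Or.inr ⟨rfl, hy⟩
          · exact absurd hyw.symm hwu
      · have hg' : ω₀ g = true := by
          rw [hω₀, Function.update_of_ne hge]; rw [Function.update_of_ne hge] at hg; exact hg
        have hyw : y ≠ w := by
          rintro rfl
          have := hcl₀ g hge (by rw [hends]; exact Sym2.mem_mk_left y z)
          rw [this] at hg'; exact absurd hg' Bool.false_ne_true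
        have hzw : z ≠ w := by
          rintro rfl
          have := hcl₀ g hge (by rw [hends]; exact Sym2.mem_mk_right y z)
          rw [this] at hg'; exact absurd hg' Bool.false_ne_true
        rcases hy with hy | ⟨hyw', _⟩
        · exact Or.inl (conn_trans hy (conn_of_openAdj ⟨g, hg', hends⟩))
        · exact absurd hyw' hyw
    have hmem : v ∈ S := mem_of_conn_of_closed hS (Or.inl (conn_refl ends ω₀ x)) h
    rcases hmem with hvc | ⟨hvw, _⟩
    · exact hvc
    · exact absurd hvw hv
  · exact conn_mono hle

end ConfigLeaf

/-! ## Series edges at an unmarked vertex of degree two -/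

section Series

variable {V : Type*} {E : Type*} [DecidableEq E]

/-- Series edges `e = {u, w}`, `f = {w, v}` at a vertex `w` whose other edges are closed in `x`:
the connections among vertices other than `w` in `x[e ↦ p][f ↦ a]` are those of
`x[f ↦ open][e ↦ p ∧ a]`. -/
lemma conn_series {ends : E → Sym2 V} {e f : E} (hef : e ≠ f) {u w v : V}
    (he : ends e = s(u, w)) (hf : ends f = s(w, v)) (hwu : w ≠ u) (hwv : w ≠ v) (x : Config E)
    (hother : ∀ e', e' ≠ e → e' ≠ f → w ∈ ends e' → x e' = false) (p a : Bool) {x' v' : V}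
    (hx' : x' ≠ w) (hv' : v' ≠ w) :
    Conn ends (Function.update (Function.update x e p) f a) x' v' ↔
      Conn ends (Function.update (Function.update x f true) e (p && a)) x' v' := by
  have he' : ends e = s(w, u) := by rw [he, Sym2.eq_swap]
  -- (i): with `f` closed, the state of `e` is irrelevant
  have hi : ∀ c : Bool, Conn ends (Function.update (Function.update x f false) e c) x' v' ↔
      Conn ends (Function.update (Function.update x f false) e false) x' v' := by
    intro c
    refine conn_update_closed_at_iff he' hwu (fun e' he'' hw => ?_) c hx' hv'
    by_cases hef' : e' = f
    · subst hef'; exact Function.update_self _ _ _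
    · rw [Function.update_of_ne hef']; exact hother e' he'' hef' hw
  -- (ii): with `e` closed, the state of `f` is irrelevant
  have hii : ∀ c : Bool, Conn ends (Function.update (Function.update x e false) f c) x' v' ↔
      Conn ends (Function.update (Function.update x e false) f false) x' v' := by
    intro c
    refine conn_update_closed_at_iff hf hwv (fun e' he'' hw => ?_) c hx' hv'
    by_cases hee' : e' = e
    · subst hee'; exact Function.update_self _ _ _
    · rw [Function.update_of_ne hee']; exact hother e' hee' he'' hw
  have hcomm : ∀ (c d : Bool), Function.update (Function.update x e c) f d =
      Function.update (Function.update x f d) e c := fun c d => Function.update_comm hef c d x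
  cases p <;> cases a
  · -- both closed
    simp only [Bool.and_false]
    rw [← hcomm false true, hii true]
  · simp only [Bool.false_and]
    rw [← hcomm false true]
  · simp only [Bool.and_false]
    rw [hcomm true false, hi true, ← hcomm false false, ← hcomm false true, hii true]
  · simp only [Bool.and_true]
    rw [hcomm true true]

/-- The multiplicities of rule (a): `muAnd a b j = #{(X, Y) : |X| = a, |Y| = b, X ∩ Y = Z}` for a
fixed `Z ⊆ {1,2,3}` with `|Z| = j`, for the mixed types `a, b ∈ {1, 2}` (`0` elsewhere). -/
def muAnd : ℕ → ℕ → ℕ → ℕ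
  | 1, 1, 0 => 6
  | 1, 1, 1 => 1
  | 1, 2, 0 => 3
  | 1, 2, 1 => 2
  | 2, 1, 0 => 3
  | 2, 1, 1 => 2
  | 2, 2, 1 => 2
  | 2, 2, 2 => 1
  | _, _, _ => 0

/-- For mixed types the merged edge never has type `3`. -/
lemma muAnd_three (k l : ℕ) (hk : k = 1 ∨ k = 2) (hl : l = 1 ∨ l = 2) : muAnd k l 3 = 0 := by
  rcases hk with rfl | rfl <;> rcases hl with rfl | rfl <;> rfl

variable [Fintype E] {R : Type*} [Field R]

omit [Fintype E] in
/-- Series edges: the state of `x[e ↦ p][f ↦ a]` is that of `x[f ↦ open][e ↦ p ∧ a]` when the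
middle vertex `w` carries no mark and its other edges are closed in `x`. -/
lemma st_series (ends : E → Sym2 V) (o a₁ a₂ a₃ b : V) {e f : E} (hef : e ≠ f) {u w v : V}
    (he : ends e = s(u, w)) (hf : ends f = s(w, v)) (hwu : w ≠ u) (hwv : w ≠ v) (hwo : w ≠ o)
    (hw1 : w ≠ a₁) (hw2 : w ≠ a₂) (hw3 : w ≠ a₃) (hwb : w ≠ b) (x : Config E)
    (hother : ∀ e', e' ≠ e → e' ≠ f → w ∈ ends e' → x e' = false) (p a : Bool) :
    st ends o a₁ a₂ a₃ b (Function.update (Function.update x e p) f a) =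
      st ends o a₁ a₂ a₃ b (Function.update (Function.update x f true) e (p && a)) := by
  have key := fun {x' v' : V} (hx' : x' ≠ w) (hv' : v' ≠ w) =>
    conn_series hef he hf hwu hwv x hother p a hx' hv'
  unfold st
  simp only [Prod.mk.injEq]
  exact ⟨decide_eq_decide.mpr (key hw2.symm hw1.symm), decide_eq_decide.mpr (key hw1.symm hwo.symm),
    decide_eq_decide.mpr (key hw2.symm hwo.symm), decide_eq_decide.mpr (key hw1.symm hwb.symm),
    decide_eq_decide.mpr (key hw2.symm hwb.symm), decide_eq_decide.mpr (key hw1.symm hw3.symm),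
    decide_eq_decide.mpr (key hw2.symm hw3.symm)⟩

/-- The finite identity behind rule (a): the `(X, Y) ↦ X ∩ Y` grouping of the copy-sets. -/
lemma sum_bool3_series (k l : ℕ) (hk : k = 1 ∨ k = 2) (hl : l = 1 ∨ l = 2)
    (T : Bool → Bool → Bool → R) :
    (∑ a : Bool, ∑ b : Bool, ∑ c : Bool, if a.toNat + b.toNat + c.toNat = l then
        (∑ p : Bool, ∑ q : Bool, ∑ r : Bool, if p.toNat + q.toNat + r.toNat = k then
          T (p && a) (q && b) (r && c) else 0) else 0) =
      ∑ j ∈ Finset.range 4, (muAnd k l j : R) *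
        ∑ p : Bool, ∑ q : Bool, ∑ r : Bool, if p.toNat + q.toNat + r.toNat = j then T p q r else 0 := by
  rcases hk with rfl | rfl <;> rcases hl with rfl | rfl <;>
    simp [Finset.sum_range_succ, muAnd] <;> ring

omit [Fintype E] in
/-- On the support of the count over `(F ∖ {f}) ∖ {e}` with `e, f` pinned closed, every edge at
`w` other than `e, f` that is pinned closed in `z` and not typed is closed. -/
lemma closed_on_support2 {ends : E → Sym2 V} {e f : E} {w : V} (F : Finset E) (z : Config E)
    (hcl : ∀ e', e' ≠ e → e' ≠ f → w ∈ ends e' → e' ∉ F ∧ z e' = false) (x : Config E)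
    (hx : ∀ e', e' ∉ (F.erase f).erase e →
      x e' = Function.update (Function.update z f false) e false e') :
    ∀ e', e' ≠ e → e' ≠ f → w ∈ ends e' → x e' = false := by
  intro e' hee' hef' hw
  obtain ⟨hF, hz⟩ := hcl e' hee' hef' hw
  rw [hx e' (fun h => hF (Finset.mem_of_mem_erase (Finset.mem_of_mem_erase h))),
    Function.update_of_ne hee', Function.update_of_ne hef']
  exact hz

/-- **Series typed edges (rule (a))**: two typed edges `e = {u, w}`, `f = {w, v}` of mixed types in
series at an unmarked vertex `w` whose other edges are all pinned closed merge into the single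
typed edge `e` with `f` pinned open (so `e` joins `u` to `v` through `w`), with the multiplicities
`muAnd`: `N_τ = Σ_j muAnd(τ e, τ f, j) · N_{τ[e := j]}(f open)`. -/
theorem typedCount_series (ends : E → Sym2 V) (o a₁ a₂ a₃ b : V) {e f : E} (hef : e ≠ f)
    {u w v : V} (he : ends e = s(u, w)) (hf : ends f = s(w, v)) (hwu : w ≠ u) (hwv : w ≠ v)
    (hwo : w ≠ o) (hw1 : w ≠ a₁) (hw2 : w ≠ a₂) (hw3 : w ≠ a₃) (hwb : w ≠ b) (F : Finset E)
    (heF : e ∈ F) (hfF : f ∈ F) (z : Config E) (τ : E → ℕ) (hτe : τ e = 1 ∨ τ e = 2)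
    (hτf : τ f = 1 ∨ τ f = 2) (hcl : ∀ e', e' ≠ e → e' ≠ f → w ∈ ends e' → e' ∉ F ∧ z e' = false) :
    typedCount F z τ (K3 ends o a₁ a₂ a₃ b : Config E → Config E → Config E → R) =
      ∑ j ∈ Finset.range 4, (muAnd (τ e) (τ f) j : R) *
        typedCount (F.erase f) (Function.update z f true) (Function.update τ e j)
          (K3 ends o a₁ a₂ a₃ b) := by
  have heF' : e ∈ F.erase f := Finset.mem_erase.2 ⟨hef, heF⟩
  have hfF'' : f ∉ (F.erase f).erase e := fun h => (Finset.mem_erase.1 (Finset.mem_erase.1 h).2).1 rfl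
  have hzT : Function.update (Function.update z f true) e false f = true := by
    rw [Function.update_of_ne (Ne.symm hef), Function.update_self]
  have hzz : Function.update (Function.update (Function.update z f true) e false) f false =
      Function.update (Function.update z f false) e false := by
    rw [Function.update_comm (Ne.symm hef), Function.update_idem, Function.update_comm hef]
  set T : Bool → Bool → Bool → R := fun p q r =>
    typedCount ((F.erase f).erase e) (Function.update (Function.update z f true) e false) τ
      (fun x y w => K3 ends o a₁ a₂ a₃ b (Function.update x e p) (Function.update y e q)
        (Function.update w e r)) with hT
  have hL : typedCount F z τ (K3 ends o a₁ a₂ a₃ b : Config E → Config E → Config E → R) =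
      ∑ a : Bool, ∑ b' : Bool, ∑ c : Bool, if a.toNat + b'.toNat + c.toNat = τ f then
        (∑ p : Bool, ∑ q : Bool, ∑ r : Bool, if p.toNat + q.toNat + r.toNat = τ e then
          T (p && a) (q && b') (r && c) else 0) else 0 := by
    rw [typedCount_split F f hfF]
    refine Finset.sum_congr rfl fun a _ => Finset.sum_congr rfl fun b' _ =>
      Finset.sum_congr rfl fun c _ => ?_
    refine if_congr Iff.rfl ?_ rfl
    rw [typedCount_split (F.erase f) e heF']
    refine Finset.sum_congr rfl fun p _ => Finset.sum_congr rfl fun q _ =>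
      Finset.sum_congr rfl fun r _ => ?_
    refine if_congr Iff.rfl ?_ rfl
    rw [hT]
    simp only
    rw [typedCount_repin_false ((F.erase f).erase e) f hfF''
      (Function.update (Function.update z f true) e false) τ _, hzT, hzz]
    refine typedCount_congr_K_on _ _ _ fun x y w hxyw _ => ?_
    have hx := closed_on_support2 F z hcl x fun e' he' => (hxyw e' he').1
    have hy := closed_on_support2 F z hcl y fun e' he' => (hxyw e' he').2.1
    have hw := closed_on_support2 F z hcl w fun e' he' => (hxyw e' he').2.2
    rw [K3_eq_KB, K3_eq_KB, st_series ends o a₁ a₂ a₃ b hef he hf hwu hwv hwo hw1 hw2 hw3 hwb x hx p a,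
      st_series ends o a₁ a₂ a₃ b hef he hf hwu hwv hwo hw1 hw2 hw3 hwb y hy q b',
      st_series ends o a₁ a₂ a₃ b hef he hf hwu hwv hwo hw1 hw2 hw3 hwb w hw r c]
  have hR : ∀ j : ℕ, typedCount (F.erase f) (Function.update z f true) (Function.update τ e j)
      (K3 ends o a₁ a₂ a₃ b : Config E → Config E → Config E → R) =
      ∑ p : Bool, ∑ q : Bool, ∑ r : Bool, if p.toNat + q.toNat + r.toNat = j then T p q r else 0 := by
    intro j
    rw [typedCount_split (F.erase f) e heF']
    refine Finset.sum_congr rfl fun p _ => Finset.sum_congr rfl fun q _ =>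
      Finset.sum_congr rfl fun r _ => ?_
    rw [Function.update_self]
    refine if_congr Iff.rfl ?_ rfl
    rw [hT]
    simp only
    refine typedCount_congr_τ _ _ (fun e' he' => ?_) _
    rw [Function.update_of_ne (Finset.ne_of_mem_erase he')]
  rw [hL]
  simp only [hR]
  exact sum_bool3_series (τ e) (τ f) hτe hτf T

/-- Rule (a) in the lead's form: `w` an unmarked vertex of degree two of the graph. -/
theorem typedCount_series_deg2 (ends : E → Sym2 V) (o a₁ a₂ a₃ b : V) {e f : E} (hef : e ≠ f)
    {u w v : V} (he : ends e = s(u, w)) (hf : ends f = s(w, v)) (hwu : w ≠ u) (hwv : w ≠ v)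
    (hdeg : ∀ e', w ∈ ends e' → e' = e ∨ e' = f) (hwo : w ≠ o) (hw1 : w ≠ a₁) (hw2 : w ≠ a₂)
    (hw3 : w ≠ a₃) (hwb : w ≠ b) (F : Finset E) (heF : e ∈ F) (hfF : f ∈ F) (z : Config E)
    (τ : E → ℕ) (hτe : τ e = 1 ∨ τ e = 2) (hτf : τ f = 1 ∨ τ f = 2) :
    typedCount F z τ (K3 ends o a₁ a₂ a₃ b : Config E → Config E → Config E → R) =
      ∑ j ∈ Finset.range 4, (muAnd (τ e) (τ f) j : R) *
        typedCount (F.erase f) (Function.update z f true) (Function.update τ e j)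
          (K3 ends o a₁ a₂ a₃ b) :=
  typedCount_series ends o a₁ a₂ a₃ b hef he hf hwu hwv hwo hw1 hw2 hw3 hwb F heF hfF z τ hτe hτf
    fun e' hee' hef' hw => by rcases hdeg e' hw with rfl | rfl <;> exact absurd rfl ‹_›

end Series

end TypedRed

end CovForm

end Summit.Ventures.PercRepro2
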